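import Summits.QuantumFields.YangMills.Theorems.BalabanUVNodesN15KingModelCurvatureFlux
import HarnessLib

/-!
# BalabanUVNodes ∕ N15 — THE KING-MODEL RUNG (PART Ϳ-n): THE HARPER FIBRATION — at the constant-flux field with momentum `p` supported on `ν₀` (`U(x,ν₁) = e^{ip′₀x₀}`, Landau gauge),
# King's covariant operator preserves the separable fields `f(x_{ν₀})·χ_q(x)` (`q_{ν₀} = 0`) and acts on the profile `f` as HARPER's operator
# `(H_qf)(j) = (m²+2(d+1)c)f(j) − c(f(j+1)+f(j−1)) − 2c·Re(e^{ip′₀j}e^{iq′_{ν₁}})f(j) − 2cΣ_{μ∉{ν₀,ν₁}}Re(e^{iq′_μ})f(j)` — the Hofstadter problem on King's torus, fibre by fibre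
# (Track A, DAG node N15 = NE2; FAN-OUT v1.1 §N15 s3 «KING-MODEL RUNG … + what the curved case adds»; count-neutral)

HONEST FRAMING.  Count-neutral (cell `pub-ymgap`, seat `pub-ymgap-dag-n15-e` g46; `--supports stmt-QuantumFields-27247 --as helper` = K3ᴬ, KEY MAP v3).  King's fine covariance layer
`−cΔ_U+m²` (Ͱ-a `covLapF`) at the `U(1)` constant-flux field on ONE finite torus; an exact structural identity (no spectral claim about Harper's operator is made — its spectrum, the
Hofstadter butterfly, has no closed form; Ϳ-c∕Ϳ-d∕Ϳ-g bound it); NOT Bałaban's `G_k(U)`; NOT [Balaban1985BackgroundPropagators] (3.42); NOT a node discharge; nothing continuum ∕ OS ∕ Clay.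

THE RESULTS (`p` supported on `ν₀`: `p_μ = 0` for `μ ≠ ν₀`; `q_{ν₀} = 0`; `ν₀ ≠ ν₁`):
* §1 `chi_add_unitVec_of_zero` (`χ_p(x+e_μ) = χ_p(x)` when `p_μ = 0`: the Landau-gauge field depends on `x_{ν₀}` only; a character with `q_{ν₀} = 0` does not see `x_{ν₀}`), `chi_sub_unitVec`
  (`χ_q(x−e_μ) = χ_q(x)·conj χ_q(e_μ)`), `kingSepVec f q (x) = f(x_{ν₀})χ_q(x)`, `harperOp` (the operator above, on `ℤ∕K_{ν₀} → ℂ`);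
* §2 ★★★ **`covLapF_fluxLink_mulVec_kingSepVec`** — `(−cΔ_U+m²)(f ⊗ χ_q) = (H_qf) ⊗ χ_q`: King's covariant operator at constant flux FIBRES over the transverse momenta `q` into one-dimensional
  quasi-periodic Jacobi (Harper) operators — translations along `ν₀` are broken to the magnetic ones of Ϳ-h, those along the other directions survive as the fibration;
* §3 `harperOp_zero_flux` (`p = 0`: the potential is the constant `−2cRe e^{iq′_{ν₁}}` — King's `A = 0` operator in mixed position∕momentum variables, cf. PART Ϲ's time slices), ★ `kingSepVec_ne_zero`.
WHAT THE CURVED CASE ADDS (as theorems): at `U ≡ 1` plane waves diagonalise King's operator completely (PART Ε); at constant flux only `d` of the `d+1` momenta survive and the remaining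
coordinate carries a quasi-periodic potential `−2c·cos(p′₀j + q′_{ν₁})` whose period is the flux denominator — the lattice Landau problem.
PRIOR TREE ART (by name, not restated): Ͱ-a (`covLapF`, `covLapF_mulVec_apply`), Ͷ-a (`unit_mulVec`), Ͻ-q (`fluxLink`), `B5Prop11Plancherel` (`chi`, `chi_add_right`, `chi_unitVec`, `chi_mul_conj` (Ͷ-c)), Ε-e
(`norm_chi_eq_one`).  Dedup (rg at filing): basename 0 files; needles `kingSepVec|harperOp|covLapF_fluxLink_mulVec_kingSepVec|chi_add_unitVec_of_zero` 0 tree files.  Locators: [King1986] (4.4) p.670, (4.35) p.674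
(plane waves); [tHooft1979Flux] NPB 153 (flux sectors, notion); Harper∕Hofstadter (notion only, no source used).  0 `sorry`, 2 `def`.
-/

noncomputable section
open scoped BigOperators ComplexConjugate ComplexOrder
open Finset Matrix

namespace Summit.QuantumFields.YangMills.BalabanUVNodes.N15KingModelRung.Curvature

open Literature.MathematicalPhysics.QuantumFieldTheory.Balaban1983to89.B5Prop11Plancherel (Tor unitVec chi chi_add_right chi_unitVec sOf)
open Summit.QuantumFields.YangMills.BalabanUVNodes.N15KingModelRung.Covariant (covLapF covLapF_mulVec_apply)
open Summit.QuantumFields.YangMills.BalabanUVNodes.N15KingModelRung.Toron (unit_mulVec chi_mul_conj)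
open Summit.QuantumFields.YangMills.BalabanUVNodes.N15KingModelRung.Cover (fluxLink)

variable {d : ℕ} (K : Fin (d + 1) → ℕ) [hK : ∀ μ, NeZero (K μ)]

/-! ## §1 Characters that ignore a coordinate; separable fields; Harper's operator -/

/-- `χ_p(x + e_μ) = χ_p(x)` when `p_μ = 0`. [folklore] -/
theorem chi_add_unitVec_of_zero {p : Tor K} {μ : Fin (d + 1)} (hp : p μ = 0) (x : Tor K) : chi K p (x + unitVec K μ) = chi K p x := by
  rw [chi_add_right, chi_unitVec, hp, AddChar.map_zero_eq_one, mul_one]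

/-- `χ_q(x − e_μ) = χ_q(x)·conj χ_q(e_μ)`. [folklore] -/
theorem chi_sub_unitVec (q x : Tor K) (μ : Fin (d + 1)) : chi K q (x - unitVec K μ) = chi K q x * conj (chi K q (unitVec K μ)) := by
  have h : chi K q x = chi K q (x - unitVec K μ) * chi K q (unitVec K μ) := by rw [← chi_add_right, sub_add_cancel]
  rw [h, mul_assoc, chi_mul_conj, mul_one]

/-- `χ_p(x − e_μ) = χ_p(x)` when `p_μ = 0`. [folklore] -/
theorem chi_sub_unitVec_of_zero {p : Tor K} {μ : Fin (d + 1)} (hp : p μ = 0) (x : Tor K) : chi K p (x - unitVec K μ) = chi K p x := by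
  rw [chi_sub_unitVec, chi_unitVec, hp, AddChar.map_zero_eq_one, map_one, mul_one]

/-- THE SEPARABLE FIELD `(f ⊗ χ_q)(x) = f(x_{ν₀})·χ_q(x)` (a profile along `ν₀` times a transverse plane wave). [cite: King1986, (4.35) p.674] -/
def kingSepVec (ν₀ : Fin (d + 1)) (f : ZMod (K ν₀) → ℂ) (q : Tor K) : Tor K × Unit → ℂ := fun z => f (z.1 ν₀) * chi K q z.1

/-- HARPER's OPERATOR on profiles `ℤ∕K_{ν₀} → ℂ` at flux momentum `p` and transverse momentum `q`:
`(H f)(j) = (m²+2(d+1)c)f(j) − c(f(j+1)+f(j−1)) − c·(χ(p₀j)χ_q(e_{ν₁}) + conj)·f(j) − cΣ_{μ∉{ν₀,ν₁}}(χ_q(e_μ) + conj χ_q(e_μ))·f(j)`. [cite: King1986, (4.4) p.670; tHooft1979Flux, NPB 153 (flux sectors, notion)] -/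
def harperOp (c m2 : ℝ) (ν₀ ν₁ : Fin (d + 1)) (p q : Tor K) (f : ZMod (K ν₀) → ℂ) : ZMod (K ν₀) → ℂ := fun j =>
  ((m2 + 2 * ((d : ℝ) + 1) * c : ℝ) : ℂ) * f j
    - (c : ℂ) * ((f (j + 1) + f (j - 1))
        + ((ZMod.stdAddChar (N := K ν₀)) (p ν₀ * j) * chi K q (unitVec K ν₁) + conj ((ZMod.stdAddChar (N := K ν₀)) (p ν₀ * j) * chi K q (unitVec K ν₁))) * f j
        + (∑ μ ∈ (Finset.univ.erase ν₀).erase ν₁, (chi K q (unitVec K μ) + conj (chi K q (unitVec K μ)))) * f j)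

/-! ## §2 The fibration -/

/-- The flux field with momentum supported on `ν₀` reads `χ_p(x) = χ(p₀·x₀)`. [folklore] -/
theorem chi_eq_stdAddChar_of_supported {p : Tor K} {ν₀ : Fin (d + 1)} (hp : ∀ μ, μ ≠ ν₀ → p μ = 0) (x : Tor K) :
    chi K p x = (ZMod.stdAddChar (N := K ν₀)) (p ν₀ * x ν₀) := by
  unfold chi
  rw [Finset.prod_eq_single ν₀ (fun μ _ hμ => by rw [hp μ hμ, zero_mul, AddChar.map_zero_eq_one]) (fun h => absurd (Finset.mem_univ _) h)]

/-- ★★★ **THE HARPER FIBRATION**: for the constant-flux field `U = fluxLink K p ν₁` with `p` supported on `ν₀ ≠ ν₁`, and a transverse momentum `q` (`q_{ν₀} = 0`):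
`(−cΔ_U+m²)(f ⊗ χ_q) = (H_{p,q}f) ⊗ χ_q` — King's covariant operator at constant flux preserves each transverse plane-wave sector and acts there as Harper's quasi-periodic Jacobi operator.
[cite: King1986, (4.4) p.670, (4.35) p.674; tHooft1979Flux, NPB 153 (flux sectors, notion)] -/
theorem covLapF_fluxLink_mulVec_kingSepVec (c m2 : ℝ) {p q : Tor K} {ν₀ ν₁ : Fin (d + 1)} (hν : ν₀ ≠ ν₁) (hp : ∀ μ, μ ≠ ν₀ → p μ = 0) (hq : q ν₀ = 0)
    (f : ZMod (K ν₀) → ℂ) :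
    covLapF K c m2 (fluxLink K p ν₁) *ᵥ kingSepVec K ν₀ f q = kingSepVec K ν₀ (harperOp K c m2 ν₀ ν₁ p q f) q := by
  funext ⟨x, i⟩
  obtain rfl : i = () := rfl
  rw [covLapF_mulVec_apply]
  simp only [kingSepVec, harperOp]
  -- split the direction sum into ν₀, ν₁ and the rest
  have hsplit : ∀ g : Fin (d + 1) → ℂ, ∑ μ, g μ = g ν₀ + g ν₁ + ∑ μ ∈ (Finset.univ.erase ν₀).erase ν₁, g μ := fun g => by
    rw [← Finset.add_sum_erase _ _ (Finset.mem_univ ν₀), ← Finset.add_sum_erase _ _ (Finset.mem_erase.mpr ⟨Ne.symm hν, Finset.mem_univ ν₁⟩), add_assoc]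
  rw [hsplit]
  -- coordinates
  have hx0 : ∀ μ, (x + unitVec K μ) ν₀ = if μ = ν₀ then x ν₀ + 1 else x ν₀ := fun μ => by
    by_cases h : μ = ν₀
    · subst h; simp [unitVec]
    · simp [unitVec, h]
  have hx0' : ∀ μ, (x - unitVec K μ) ν₀ = if μ = ν₀ then x ν₀ - 1 else x ν₀ := fun μ => by
    by_cases h : μ = ν₀
    · subst h; simp [unitVec]
    · simp [unitVec, h]
  -- the link entries
  have hU : ∀ y μ, fluxLink K p ν₁ (y, μ) = if μ = ν₁ then Matrix.of (fun _ _ => chi K p y) else 1 := fun y μ => rfl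
  -- direction ν₀ : U = 1, the character does not move (q_{ν₀} = 0)
  have h0a : ((fluxLink K p ν₁ (x, ν₀)) *ᵥ fun j => f ((x + unitVec K ν₀) ν₀) * chi K q (x + unitVec K ν₀)) () = f (x ν₀ + 1) * chi K q x := by
    rw [hU, if_neg hν, Matrix.one_mulVec, hx0, if_pos rfl, chi_add_unitVec_of_zero K hq]
  have h0b : ((fluxLink K p ν₁ (x - unitVec K ν₀, ν₀))ᴴ *ᵥ fun j => f ((x - unitVec K ν₀) ν₀) * chi K q (x - unitVec K ν₀)) () = f (x ν₀ - 1) * chi K q x := by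
    rw [hU, if_neg hν, conjTranspose_one, Matrix.one_mulVec, hx0', if_pos rfl, chi_sub_unitVec_of_zero K hq]
  -- direction ν₁ : U = χ_p(x) = χ(p₀x₀) (the same at x and x − e_{ν₁}), the character picks up χ_q(e_{ν₁})^{±1}
  have hpx : chi K p x = (ZMod.stdAddChar (N := K ν₀)) (p ν₀ * x ν₀) := chi_eq_stdAddChar_of_supported K hp x
  have hpx' : chi K p (x - unitVec K ν₁) = (ZMod.stdAddChar (N := K ν₀)) (p ν₀ * x ν₀) := by rw [chi_sub_unitVec_of_zero K (hp ν₁ (Ne.symm hν)), hpx]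
  have h1a : ((fluxLink K p ν₁ (x, ν₁)) *ᵥ fun j => f ((x + unitVec K ν₁) ν₀) * chi K q (x + unitVec K ν₁)) ()
      = (ZMod.stdAddChar (N := K ν₀)) (p ν₀ * x ν₀) * chi K q (unitVec K ν₁) * (f (x ν₀) * chi K q x) := by
    rw [hU, if_pos rfl, unit_mulVec, Matrix.of_apply, hx0, if_neg (Ne.symm hν), chi_add_right, hpx]; ring
  have h1b : ((fluxLink K p ν₁ (x - unitVec K ν₁, ν₁))ᴴ *ᵥ fun j => f ((x - unitVec K ν₁) ν₀) * chi K q (x - unitVec K ν₁)) ()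
      = conj ((ZMod.stdAddChar (N := K ν₀)) (p ν₀ * x ν₀) * chi K q (unitVec K ν₁)) * (f (x ν₀) * chi K q x) := by
    rw [hU, if_pos rfl, unit_mulVec, Matrix.conjTranspose_apply, Matrix.of_apply, hx0', if_neg (Ne.symm hν), hpx', chi_sub_unitVec, Complex.star_def, map_mul (starRingEnd ℂ)]; ring
  -- the other directions : U = 1, the character picks up χ_q(e_μ)^{±1}
  have hrest : ∑ μ ∈ (Finset.univ.erase ν₀).erase ν₁,
      (((fluxLink K p ν₁ (x, μ)) *ᵥ fun j => f ((x + unitVec K μ) ν₀) * chi K q (x + unitVec K μ)) ()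
        + (((fluxLink K p ν₁ (x - unitVec K μ, μ)))ᴴ *ᵥ fun j => f ((x - unitVec K μ) ν₀) * chi K q (x - unitVec K μ)) ())
      = (∑ μ ∈ (Finset.univ.erase ν₀).erase ν₁, (chi K q (unitVec K μ) + conj (chi K q (unitVec K μ)))) * (f (x ν₀) * chi K q x) := by
    rw [Finset.sum_mul]
    refine Finset.sum_congr rfl fun μ hμ => ?_
    have hμ1 : μ ≠ ν₁ := Finset.ne_of_mem_erase hμ
    have hμ0 : μ ≠ ν₀ := Finset.ne_of_mem_erase (Finset.mem_of_mem_erase hμ)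
    rw [hU, if_neg hμ1, hU, if_neg hμ1, conjTranspose_one, Matrix.one_mulVec, Matrix.one_mulVec, hx0, if_neg hμ0, hx0', if_neg hμ0, chi_add_right, chi_sub_unitVec]; ring
  rw [hrest, h0a, h0b, h1a, h1b]
  simp only [RCLike.ofReal_eq_complex_ofReal]
  push_cast
  ring

/-! ## §3 Remarks: zero flux; non-triviality -/

/-- At `p = 0` (no flux) Harper's potential is the constant `χ_q(e_{ν₁}) + conj` — King's `A = 0` operator in mixed variables (position along `ν₀`, momenta elsewhere). [cite: King1986, (4.4) p.670] -/
theorem harperOp_zero_flux (c m2 : ℝ) (ν₀ ν₁ : Fin (d + 1)) (q : Tor K) (f : ZMod (K ν₀) → ℂ) (j : ZMod (K ν₀)) :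
    harperOp K c m2 ν₀ ν₁ 0 q f j = ((m2 + 2 * ((d : ℝ) + 1) * c : ℝ) : ℂ) * f j
      - (c : ℂ) * ((f (j + 1) + f (j - 1)) + (chi K q (unitVec K ν₁) + conj (chi K q (unitVec K ν₁))) * f j
        + (∑ μ ∈ (Finset.univ.erase ν₀).erase ν₁, (chi K q (unitVec K μ) + conj (chi K q (unitVec K μ)))) * f j) := by
  simp only [harperOp, Pi.zero_apply, zero_mul, AddChar.map_zero_eq_one, one_mul]

/-- ★ The separable field is non-zero as soon as the profile is (`|χ| = 1`). [folklore] -/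
theorem kingSepVec_ne_zero (ν₀ : Fin (d + 1)) {f : ZMod (K ν₀) → ℂ} {j : ZMod (K ν₀)} (hf : f j ≠ 0) (q : Tor K) : kingSepVec K ν₀ f q ≠ 0 := by
  intro h
  have hx := congr_fun h (Pi.single ν₀ j, ())
  simp only [kingSepVec, Pi.single_eq_same, Pi.zero_apply, mul_eq_zero] at hx
  rcases hx with hx | hx
  · exact hf hx
  · have := Summit.QuantumFields.YangMills.BalabanUVNodes.N15KingModelRung.TorusSpectral.norm_chi_eq_one K q (Pi.single ν₀ j)
    rw [hx, norm_zero] at this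
    exact zero_ne_one this

end Summit.QuantumFields.YangMills.BalabanUVNodes.N15KingModelRung.Curvature

end
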